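import Summits.SmoothPoincare4.SmoothPoincare4.Theorems.CongruenceShadowsAgkCor6Sufficiency
import Literature.Topology.FourManifolds.TrisectionStabilizationDatumAssemblyOne

/-!
# Crux `AgkCor6Sufficiency` (item stmt-SmoothPoincare4-10894): the Nielsen-free last step
# (lead reshape r6 of line `lp-by-sphere-system-surgery`)

The landed assembly `CongruenceShadowsAgkCor6Sufficiency.lean` proves both route decls from four
named facts: Laudenbach–Poénaru `exists_diffeomorph_comp_incl_eq`, `GriffithsExtension`,
`DehnNielsenBaerSurfaceSmooth` (together giving rigidity (b′), `rigidity_of_facts`) and (c′)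
`exists_stabilized_gkTrisection` (stabilisation compatibility for ALL markings, up to `Iso`), whose
in-tree staging `exists_stabilized_gkTrisection_of_geometric_of_nielsen` needs, besides the
geometric stabilisation, NIELSEN's lifting theorem for automorphisms of the surface group `S_g`.

This file removes (c′) — and with it Nielsen lifting — from the load path of the crux.  The tree's
deciding theorem `spc4_of_forall_isStablyTrivial_of_stabilizableMarking` (TrisectionFunctorSPC4Proofs
§11) needs, besides GK Thm 4 (proved) and (b′), only the standard trisections of `S⁴` (d′) and ONE
stabilisable based marking per balanced trisection realised ON THE NOSE (G).  Both follow from two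
purely geometric statements about Gay–Kirby trisections with corners:

* `GeomMarkingStmt` — every balanced GK trisection of a closed connected oriented smooth
  4-manifold carries a based marking with a joint-chart datum `JCD` (a joint chart with linear
  sectors, the chart cell, and a free basis of `π₁` of the central surface minus the cell in
  which the boundary circle reads `r_g = ∏ [aᵢ, bᵢ]`);
* `JCDStepStmt` — ONE unbalanced stabilisation (Gay–Kirby's implant in sector `i`, proof of
  Lemma 10, one eye) of a JCD-marked trisection is JCD-marked, with kernel triple
  `𝒢.stabilizeOne i` ON THE NOSE, over a general closed `X` (its `S⁴` instance is verbatim the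
  hypothesis of the tree's `sphere_gkTrisections_of_jointChartDatum_stabilizeOne_step`; its
  geometric half is the tree's proved `IsGKTrisection.exists_stabilization_chart`, its `π₁`
  stage the tree's proved `exists_marking_groupGKTrisectionOf_eq_stabilizeOne_datum`);

by `sphere_gkTrisections_of_jcdStep` ((d′)) and `stabilizableMarking_of_geomMarking_of_jcdStep`
((G): three JCD steps in sectors `2, 1, 0` are a balanced step with kernel triple `𝒢.stabilize`,
`TrisectionKernels.stabilize_eq_stabilizeOne`, iterated by `stabilizableMarking_of_oneStep`).
Whence `agkCor6Sufficiency_of_facts_nielsenFree` / `agkCor6Sufficiency'_of_facts_nielsenFree`: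
BOTH route decls from LP, Griffiths, Dehn–Nielsen–Baer and the two geometric statements — a
CONDITIONAL result (the two statements are the registered stubs `stub_geomMarking`,
`stub_jcdStep` of the line's skeleton r6).

References: Abrams–Gay–Kirby, Geom. Topol. 22 (2018), Def. 2–3, Thm. 5 and Cor. 6
[AbramsGayKirby2018]; Gay–Kirby, Geom. Topol. 20 (2016), Def. 1, Def. 8, Lemma 10 and its proof
[GayKirby2016].
-/

set_option linter.dupNamespace false

noncomputable section

open Set Function ContinuousMap
open scoped Manifold ContDiff Topology

namespace Summit.SmoothPoincare4.SmoothPoincare4.Cruxes.AgkCor6Sufficiency.LpBySphereSystemSurgery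

open Literature.Topology.FourManifolds
open Summit.SmoothPoincare4.SmoothPoincare4.Theses.CongruenceShadows (AgkCor6Sufficiency)

/-! ## 1. Vocabulary -/

section JCDVocabulary

open Metric
open Literature.AlgebraicTopology.FundamentalGroup
open Literature.AlgebraicTopology.FundamentalGroup.VanKampen

/-- **The joint-chart datum of a based marked Gay–Kirby trisection** — verbatim the hypothesis of
the tree's `sphere_gkTrisections_of_jointChartDatum_stabilizeOne_step` over a general `X`: a chart
`Θ` of the maximal atlas in which the three sectors are the linear wedges of the normal plane and the
central surface `F = ⋂ S m` is `{Θ₀ = Θ₁ = 0}`; the cell `Φ(z) = Θ⁻¹(0, 0, ρ z)` on `B̄(0, 2)`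
with `F ∩ O = Φ(B(0,2))` for the tube `O = {‖(Θ₂, Θ₃)‖ < 2ρ}`; the base point `x₀ = Φ(1, 0)`;
`F ∖ Φ(B(0,1))` path connected; and a free basis `θ_A` of `π₁(F ∖ Φ(B(0,1)), x₀)` with
`θ_A(r_g) = [∂]` (the class `t` of the circle `Φ(S(0,1))`, a generator of its `π₁`) through
which the marking reads, `μ ∘ mk = (A ⊆ F)_* ∘ θ_A` (Gay–Kirby 2016, Def. 1 and proof of Lemma 10;
Abrams–Gay–Kirby 2018, Def. 2).  A statement-vocabulary predicate of this line, not a cited fact. -/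
def JCD (X : Type) [TopologicalSpace X] [ChartedSpace (EuclideanSpace ℝ (Fin 4)) X] (g : ℕ)
    (S : Fin 3 → Set X) (x₀ : centralSurface S)
    (μ : SurfaceGroup g ≃* FundamentalGroup (centralSurface S) x₀) : Prop :=
  ∃ (Θ : OpenPartialHomeomorph X (EuclideanSpace ℝ (Fin 4))) (i j l : Fin 3) (ρ : ℝ)
    (Φ : C(closedBall (0 : EuclideanSpace ℝ (Fin 2)) 2, X)) (O : Set X),
    Θ ∈ IsManifold.maximalAtlas (𝓡 4) ∞ X ∧
    j ≠ i ∧ l ≠ i ∧ l ≠ j ∧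
    (∀ y ∈ Θ.source, y ∈ S i ↔ (0 ≤ Θ y 0 ∧ 0 ≤ Θ y 1)) ∧
    (∀ y ∈ Θ.source, y ∈ (⋂ m, S m) ↔ (Θ y 0 = 0 ∧ Θ y 1 = 0)) ∧
    (∀ y ∈ Θ.source, y ∈ S j ↔ (Θ y 0 ≤ 0 ∧ Θ y 0 ≤ Θ y 1)) ∧
    (∀ y ∈ Θ.source, y ∈ S l ↔ (Θ y 1 ≤ 0 ∧ Θ y 1 ≤ Θ y 0)) ∧
    0 < ρ ∧ (∀ z, Φ z ∈ Θ.source) ∧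
    (∀ z, Θ (Φ z) =
      !₂[0, 0, ρ * (z : EuclideanSpace ℝ (Fin 2)) 0, ρ * (z : EuclideanSpace ℝ (Fin 2)) 1]) ∧
    Injective Φ ∧ range Φ ⊆ (⋂ m, S m) ∧ IsOpen O ∧ O ⊆ Θ.source ∧
    O = {y | y ∈ Θ.source ∧ ‖(!₂[Θ y 2, Θ y 3] : EuclideanSpace ℝ (Fin 2))‖ < 2 * ρ} ∧
    (⋂ m, S m) ∩ O = Φ '' {z | ‖(z : EuclideanSpace ℝ (Fin 2))‖ < 2} ∧
    (x₀ : X) = Φ ⟨Complex.orthonormalBasisOneI.repr 1, closedBall_subset_closedBall one_le_two (by simp)⟩ ∧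
    IsPathConnected ((⋂ m, S m) \ Φ '' {z | ‖(z : EuclideanSpace ℝ (Fin 2))‖ < 1}) ∧
    ∃ (hx₀C : (x₀ : X) ∈ Φ '' {z | ‖(z : EuclideanSpace ℝ (Fin 2))‖ = 1})
      (hCA : Φ '' {z | ‖(z : EuclideanSpace ℝ (Fin 2))‖ = 1} ⊆
        (⋂ m, S m) \ Φ '' {z | ‖(z : EuclideanSpace ℝ (Fin 2))‖ < 1})
      (hAF : (⋂ m, S m) \ Φ '' {z | ‖(z : EuclideanSpace ℝ (Fin 2))‖ < 1} ⊆ ⋂ m, S m)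
      (t : FundamentalGroup ↥(Φ '' {z | ‖(z : EuclideanSpace ℝ (Fin 2))‖ = 1}) ⟨_, hx₀C⟩)
      (θA : FreeGroup (surfaceGen g) ≃*
        FundamentalGroup ↥((⋂ m, S m) \ Φ '' {z | ‖(z : EuclideanSpace ℝ (Fin 2))‖ < 1}) ⟨_, hCA hx₀C⟩),
      Subgroup.closure {t} = ⊤ ∧
      θA (surfaceRelator g) = inclHomOfSubset hCA _ hx₀C (hCA hx₀C) t ∧
      μ.toMonoidHom.comp (PresentedGroup.mk _) =
        (inclHomOfSubset hAF _ (hCA hx₀C) (hAF (hCA hx₀C))).comp θA.toMonoidHom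

/-- **Geometric marking** (statement of `stub_geomMarking`): every balanced Gay–Kirby trisection of
a closed connected oriented smooth `4`-manifold admits a base point and a marking of its central
surface carrying a joint-chart datum `JCD` (Gay–Kirby 2016, Def. 1: the central surface is a
closed orientable genus-`g` surface; Hatcher, Algebraic Topology, §1.2 p. 51).  Statement of a
registered stub of this line, not a cited fact. -/
def GeomMarkingStmt : Prop :=
  ∀ (X : Type) [TopologicalSpace X] [T2Space X] [SecondCountableTopology X]
    [ChartedSpace (EuclideanSpace ℝ (Fin 4)) X] [IsManifold (𝓡 4) ∞ X] [CompactSpace X]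
    [ConnectedSpace X] (_ : SmoothOrientation (𝓡 4) X) (g k : ℕ) (S : Fin 3 → Set X)
    (_ : IsBalancedGKTrisection X g k S),
    ∃ (x₀ : centralSurface S) (μ : SurfaceGroup g ≃* FundamentalGroup (centralSurface S) x₀),
      JCD X g S x₀ μ

/-- **The JCD step** (statement of `stub_jcdStep`): for each sector `i`, every based marked
Gay–Kirby `(g; k)`-trisection of a closed connected smooth `4`-manifold carrying a joint-chart
datum admits a based marked `(g + 1; k + [· = i])`-trisection carrying a joint-chart datum whose
kernel triple is the unbalanced stabilisation `𝒢(h, x₀, μ).stabilizeOne i` ON THE NOSE (Gay–Kirby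
2016, proof of Lemma 10, one eye; Abrams–Gay–Kirby 2018, Def. 2–3).  Its `S⁴` instance is the
hypothesis `step` of the tree's `sphere_gkTrisections_of_jointChartDatum_stabilizeOne_step`
(Gay–Kirby 2016, proof of Lemma 10, arXiv pp. 31–32; Abrams–Gay–Kirby 2018, Def. 2–3).  Statement
of a registered stub of this line, not a cited fact. -/
def JCDStepStmt : Prop :=
  ∀ (X : Type) [TopologicalSpace X] [T2Space X] [SecondCountableTopology X]
    [ChartedSpace (EuclideanSpace ℝ (Fin 4)) X] [IsManifold (𝓡 4) ∞ X] [CompactSpace X]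
    [ConnectedSpace X] (i : Fin 3) (g : ℕ) (k : Fin 3 → ℕ) (S : Fin 3 → Set X)
    (h : IsGKTrisection X g k S) (x₀ : centralSurface S)
    (μ : SurfaceGroup g ≃* FundamentalGroup (centralSurface S) x₀),
    JCD X g S x₀ μ →
      ∃ (S' : Fin 3 → Set X) (h' : IsGKTrisection X (g + 1) (Function.update k i (k i + 1)) S')
        (x₀' : centralSurface S')
        (μ' : SurfaceGroup (g + 1) ≃* FundamentalGroup (centralSurface S') x₀'),
        JCD X (g + 1) S' x₀' μ' ∧
          groupGKTrisectionOf h' x₀' μ' = (groupGKTrisectionOf h x₀ μ).stabilizeOne i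

end JCDVocabulary

/-! ## 2. Glue (proved) -/

section NielsenFreeGlue

/-- **(d′) from the JCD step**: the `S⁴` instance of `JCDStepStmt` is the hypothesis of the tree's
`sphere_gkTrisections_of_jointChartDatum_stabilizeOne_step` (base: Gay–Kirby's genus-`0`
trisection of `S⁴` with its joint-chart datum, proved in the tree). [cite: GayKirby2016, §2 and Lemma 10] -/
theorem sphere_gkTrisections_of_jcdStep (hJ : JCDStepStmt) : sphere_gkTrisections := by
  refine sphere_gkTrisections_of_jointChartDatum_stabilizeOne_step ?_
  intro i g k S h x₀ μ hd
  exact hJ (Metric.sphere (0 : EuclideanSpace ℝ (Fin 5)) 1) i g k S h x₀ μ hd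

/-- **(G) from the geometric marking and the JCD step**: inside the class `JCD` of based markings,
three JCD steps in sectors `2, 1, 0` form a balanced `(g, k) ↦ (g + 3, k + 1)` step whose kernel
triple is `𝒢.stabilize` on the nose (`TrisectionKernels.stabilize_eq_stabilizeOne`), and the tree's
`stabilizableMarking_of_oneStep` iterates it. [cite: AbramsGayKirby2018, Def. 3 (p. 1540) and Thm. 5 (p. 1541)]
[cite: GayKirby2016, Def. 8 and Lemma 10] -/
theorem stabilizableMarking_of_geomMarking_of_jcdStep (hGM : GeomMarkingStmt) (hJ : JCDStepStmt)
    (X : Type) [TopologicalSpace X] [T2Space X] [SecondCountableTopology X]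
    [ChartedSpace (EuclideanSpace ℝ (Fin 4)) X] [IsManifold (𝓡 4) ∞ X] [CompactSpace X]
    [ConnectedSpace X] (o : SmoothOrientation (𝓡 4) X) (g k : ℕ) (S : Fin 3 → Set X)
    (h : IsBalancedGKTrisection X g k S) :
    ∃ (x₀ : centralSurface S) (μ : SurfaceGroup g ≃* FundamentalGroup (centralSurface S) x₀),
      ∀ n : ℕ, ∃ (S' : Fin 3 → Set X) (h' : IsBalancedGKTrisection X (g + 3 * n) (k + n) S')
        (x₀' : centralSurface S')
        (μ' : SurfaceGroup (g + 3 * n) ≃* FundamentalGroup (centralSurface S') x₀'),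
        groupGKTrisectionOf h' x₀' μ' = (groupGKTrisectionOf h x₀ μ).stabilizeIter n := by
  refine stabilizableMarking_of_oneStep (fun X _ _ g _ S _ x₀ μ => JCD X g S x₀ μ)
    (fun X _ _ _ _ _ _ _ o g k S h => hGM X o g k S h) ?_ X o g k S h
  intro X _ _ _ _ _ _ _ o g k S h x₀ μ hd
  -- transporting `JCD` and `𝒢` along an equality of the vectors of `1`-handle counts
  have transport : ∀ {g' : ℕ} {kv kv' : Fin 3 → ℕ} (_ : kv = kv') {S' : Fin 3 → Set X}
      (h' : IsGKTrisection X g' kv S') (x : centralSurface S')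
      (μ : SurfaceGroup g' ≃* FundamentalGroup (centralSurface S') x),
      JCD X g' S' x μ →
        ∃ h'' : IsGKTrisection X g' kv' S',
          JCD X g' S' x μ ∧ groupGKTrisectionOf h'' x μ = groupGKTrisectionOf h' x μ := by
    intro g' kv kv' e
    subst e
    intro S' h' x μ hg
    exact ⟨h', hg, rfl⟩
  -- three implants, in sectors `2`, `1`, `0`
  obtain ⟨S₁, h₁, x₁, μ₁, hd₁, e₁⟩ := hJ X 2 g (fun _ => k) S h x₀ μ hd
  obtain ⟨S₂, h₂, x₂, μ₂, hd₂, e₂⟩ := hJ X 1 (g + 1) _ S₁ h₁ x₁ μ₁ hd₁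
  obtain ⟨S₃, h₃, x₃, μ₃, hd₃, e₃⟩ := hJ X 0 (g + 1 + 1) _ S₂ h₂ x₂ μ₂ hd₂
  -- the counts came back balanced
  have ek : Function.update (Function.update (Function.update (fun _ : Fin 3 => k) 2 (k + 1)) 1
      (Function.update (fun _ : Fin 3 => k) 2 (k + 1) 1 + 1)) 0
      (Function.update (Function.update (fun _ : Fin 3 => k) 2 (k + 1)) 1
        (Function.update (fun _ : Fin 3 => k) 2 (k + 1) 1 + 1) 0 + 1) = fun _ => k + 1 := by
    funext m
    fin_cases m <;> simp
  obtain ⟨h', hd', e'⟩ := transport ek h₃ x₃ μ₃ hd₃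
  refine ⟨S₃, h', x₃, μ₃, hd', ?_⟩
  rw [e', TrisectionKernels.stabilize_eq_stabilizeOne, ← e₁, ← e₂, ← e₃]

end NielsenFreeGlue

/-! ## 3. The results -/

/-- **The crux of route `CongruenceShadows` WITHOUT (c′) / Nielsen lifting**: from the three
classical facts Laudenbach–Poénaru, Griffiths, Dehn–Nielsen–Baer (giving rigidity (b′),
`rigidity_of_facts`) and the two geometric statements `GeomMarkingStmt`, `JCDStepStmt`, through
the tree's `spc4_of_forall_isStablyTrivial_of_stabilizableMarking` — CONDITIONAL result.
[cite: AbramsGayKirby2018, Cor. 6 and Thm. 5 (p. 1541)] -/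
theorem agkCor6Sufficiency_of_facts_nielsenFree (hLP : exists_diffeomorph_comp_incl_eq.{0})
    (hGr : GriffithsExtension) (hDS : DehnNielsenBaerSurfaceSmooth) (hGM : GeomMarkingStmt)
    (hJ : JCDStepStmt) : AgkCor6Sufficiency :=
  fun hst M _ _ _ =>
    spc4_of_forall_isStablyTrivial_of_stabilizableMarking exists_isBalancedGKTrisection_holds
      (rigidity_of_facts hLP hGr hDS) (sphere_gkTrisections_of_jcdStep hJ)
      (stabilizableMarking_of_geomMarking_of_jcdStep hGM hJ) hst M

/-- **The same for the shared decl of route `GroupTrisection`** (identical body) — CONDITIONAL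
result. [cite: AbramsGayKirby2018, Cor. 6 and Thm. 5 (p. 1541)] -/
theorem agkCor6Sufficiency'_of_facts_nielsenFree (hLP : exists_diffeomorph_comp_incl_eq.{0})
    (hGr : GriffithsExtension) (hDS : DehnNielsenBaerSurfaceSmooth) (hGM : GeomMarkingStmt)
    (hJ : JCDStepStmt) :
    Summit.SmoothPoincare4.SmoothPoincare4.Theses.GroupTrisection.AgkCor6Sufficiency :=
  fun hst M _ _ _ =>
    spc4_of_forall_isStablyTrivial_of_stabilizableMarking exists_isBalancedGKTrisection_holds
      (rigidity_of_facts hLP hGr hDS) (sphere_gkTrisections_of_jcdStep hJ)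
      (stabilizableMarking_of_geomMarking_of_jcdStep hGM hJ) hst M

end Summit.SmoothPoincare4.SmoothPoincare4.Cruxes.AgkCor6Sufficiency.LpBySphereSystemSurgery

end
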